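import Summits.Ventures.QEC.Census.LP.LP128w8.Distance
import Summits.Ventures.QEC.Census.LPTyped
import HarnessLib

/-!
# `LP128w8` IS Panteleev–Kalachev's `LP(A, A*)`, `A = (x^{E i j})` 4 × 4 over `𝔽₂[x]/(x⁴ − 1)` — the census row `[[128, 22, 8]]` on the TYPED construction

The census object `LP128w8.cert.code _` (explicit check words, `Census/LP/LP128w8/Cert.lean`, qec-search-4 g4's KERNEL row via
the orbit-averaged information-set lane; census id `LP_4x4_l4_E0-0-0-0.0-0-1-1.0-1-0-1.0-1-3-2`, cell D.1-lite) is, along the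
layout bijections `LPTyped.rowEquiv2` / `colEquiv2` (`r = 4·(4i + s) + a`, `q = 4·c + t` with `c = 4j + s` for the `A ⊗ I`
columns and `c = 16 + 4s' + j'` for the `I ⊗ A*` columns — census/search-4 s4lib `lp(A, A*)`), EXACTLY the flat check-matrix
pair `(𝔅H_X(A,A*), 𝔅H_Z(A,A*))` of the typed lifted product `LPTyped.lpCodeSelf 4 E` (`Literature/…/LiftedProduct.lean`:
`LiftedProduct.xMatrix A (blockStar A)` / `zMatrix A (blockStar A)` over `4 × 4` circulant blocks): `HX_eq`, `HZ_eq` by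
`decide +kernel` on the product-free entry formulas `LiftedProduct.xMatrix_eq_of_xEntry` / `zMatrix_eq_of_zEntry`
(64 × 128 entries each). Hence the KERNEL theorem `LP128w8.isCode` transports (type-05 FACT P, `CSSCode.isCode_iff_of_submatrix`)
to **`isCode_lp : (lpCodeSelf 4 E).IsCode 128 22 8`** — a `[[128,22,8]]` theorem about the TYPED `LP(A, A*)` object; with
`LiftedProduct.dX_eq_dZ_of_lp_self` this family is `X/Z`-balanced by theorem. This completes the typed column of cell
D.1-lite (9/9 rows KERNEL, 9/9 typed). Tier KERNEL, axioms standard, no `native_decide`. qec-search-4 g4 (pattern of g3's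
`LP96w8/Typed.lean`; `Cert.lean` / `Distance.lean` untouched).
-/

set_option autoImplicit false

namespace Summit.Ventures.QEC.Census.LP128w8

open Matrix Literature.InformationTheory.QuantumCodes LiftedProduct Summit.Ventures.QEC.Census.LPTyped

/-- Exponent matrix `E` of `A` (4 × 4; `A i j = x^{E i j}`). (definition) -/
def E : Fin 4 → Fin 4 → ℕ := ![![0, 0, 0, 0], ![0, 0, 1, 1], ![0, 1, 0, 1], ![0, 1, 3, 2]]

/-- The commutation proof that names the census CSS code (as in `Distance.lean`). -/
theorem commOK_cert : commOK LP128w8.cert.n LP128w8.cert.HX LP128w8.cert.HZ = true :=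
  LP128w8.cert.commOK_of_checkStructure checkStructure_ok

/-- **The census object's `H^X` is `𝔅(H_X(A, A*))` relabelled** (`decide +kernel` over all `64 × 128` entries of the
product-free entry formula). -/
theorem HX_eq : (LP128w8.cert.code commOK_cert).HX =
    (lpCodeSelf 4 E).HX.submatrix ((finCongr (by decide)).trans (rowEquiv2 4 4 4))
      ((finCongr (by decide)).trans (colEquiv2 4 4 4)) := by
  change rowMatrix _ _ = (xMatrix _ _).submatrix _ _
  rw [xMatrix_eq_of_xEntry]
  decide +kernel

/-- **The census object's `H^Z` is `𝔅(H_Z(A, A*))` relabelled** (`decide +kernel`, `64 × 128` entries). -/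
theorem HZ_eq : (LP128w8.cert.code commOK_cert).HZ =
    (lpCodeSelf 4 E).HZ.submatrix ((finCongr (by decide)).trans (rowEquiv2 4 4 4))
      ((finCongr (by decide)).trans (colEquiv2 4 4 4)) := by
  change rowMatrix _ _ = (zMatrix _ _).submatrix _ _
  rw [zMatrix_eq_of_zEntry]
  decide +kernel

/-- **Panteleev–Kalachev's `LP(A, A*)` with `A = (x^{E i j})`, `E = [0 0 0 0; 0 0 1 1; 0 1 0 1; 0 1 3 2]` over `𝔽₂[x]/(x⁴ − 1)`
is a `[[128, 22, 8]]` code** — the KERNEL census row `LP128w8.isCode` transported to the typed construction by type-05's FACT P.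
[cite: PanteleevKalachev2022LP] -/
theorem isCode_lp : (lpCodeSelf 4 E).IsCode 128 22 8 :=
  (CSSCode.isCode_iff_of_submatrix HX_eq HZ_eq 128 22 8).1 isCode

/-- `d_X = d_Z` for this `LP(A, A*)` code from the family theorem (`LiftedProduct.dX_eq_dZ_of_lp_self`), independently of the
certificate. -/
theorem dX_eq_dZ_typed : (lpCodeSelf 4 E).dX = (lpCodeSelf 4 E).dZ :=
  dX_eq_dZ_of_lp_self (A := monoBlocks 4 E) rfl rfl

/-- **The census object is a lifted-product code** in the sense of qec-type-07's predicate `IsLiftedProduct` (PARTITION row 07):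
witnesses `ℓ = 4`, `A = monoBlocks 4 E` (4 × 4), `B = A* = blockStar A`, the layout bijections `rowEquiv2`/`colEquiv2`,
element-wise commutation `elementwiseCommute_mono_star`, and `HX_eq` / `HZ_eq`. [cite: PanteleevKalachev2022LP, §III.D Example 3] -/
theorem isLiftedProduct : IsLiftedProduct (LP128w8.cert.code commOK_cert).HX (LP128w8.cert.code commOK_cert).HZ :=
  ⟨4, 4, 4, 4, 4, monoBlocks 4 E, blockStar (monoBlocks 4 E), (finCongr (by decide)).trans (rowEquiv2 4 4 4),
    (finCongr (by decide)).trans (rowEquiv2 4 4 4), (finCongr (by decide)).trans (colEquiv2 4 4 4),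
    elementwiseCommute_mono_star 4 E, HX_eq, HZ_eq⟩

end Summit.Ventures.QEC.Census.LP128w8
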